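import Summits.MatrixMultiplication.MatrixMultiplication.Theorems.FarEdgeDescentLogRateLayers

/-!
# Route `FarEdgeDescent` — aside `LogRate` (stmt-MatrixMultiplication-25370), PROVED

`∀ k ≥ 1, ω(1,k,1) ≤ k + 1 + log 2 / log(2k+2)`: the first-power `CW_{2k+2}` laser method in the
far-rectangular weighting (Coppersmith 1982; Lotti–Romani 1983 Prop. 4.1; BCS 1997 Thm. 15.41), where the
entropy bound collapses to a closed form.  Kernel written by the decomp-mm lens-2 planner seat
(gen 4, rev f; `FarEdgeDescentLogRate.lean` sha256 07919df6…eefd, rc 0 · 0 sorry · std axioms, critic-endorsed)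
and landed in two files (gate rule: Theorems files with proofs ≤ 400 lines; statements and proofs unchanged):
`Theorems/FarEdgeDescentLogRateLayers.lean` (layers B1′ `cwFullDiagonalRaw`, C′ `cwFullThreshold`) and this
file (layer B2′: marginals, entropies, `Γ_S(P) = 0` on the whole CW support; layer D′: the certificate
`cwFirstPowerIntegerCertificate_holds` for the general integer joint type `(m, m, k·m; s, s, r)`; the
`s = r = 0` slice, the closed form at `q = 2k+2`, and the closer `logRate`).  The tree's landed
`Theorems/ShapeSubmodularityPerfectAmortisation*.lean` chain proves the same `s = r = 0` certificate; its stub A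
`PerfectAmortisation.stub_cwRectRestriction` is IMPORTED (the draft's verbatim layer-A copy is dropped, gate rule
`dedup.landed`); layers B1′/B2′/C′/D′ are the general-joint-type versions and are new.
-/

set_option linter.dupNamespace false

noncomputable section

open Finset
open scoped BigOperators

namespace Summit.MatrixMultiplication.MatrixMultiplication.Theorems.FarEdgeDescentLogRate

open Literature.Computability.AlgebraicComplexity
open Literature.Barriers.MatrixMultiplication (bigCwTensor)
open Summit.MatrixMultiplication.MatrixMultiplication.Theorems.PerfectAmortisation
  (stub_cwRectRestriction)  -- layer A, imported from the tree

/-! ## Layer B2′ — marginals, entropies (nats), and `Γ_S(P) = 0` on the whole CW support -/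

/-- `−(a log a + b log b + c log c)` (Shannon entropy of a three-point law, in nats). -/
def shannon₃ (a b c : ℝ) : ℝ := -(a * Real.log a + b * Real.log b + c * Real.log c)

/-- `log 2 · H_bits(a,b,c) = shannon₃ a b c`. [folklore] -/
theorem log_two_mul_shannonEntropy_vec3 (a b c : ℝ) :
    Real.log 2 * shannonEntropy ![a, b, c] = shannon₃ a b c := by
  have hlog : Real.log 2 ≠ 0 := (Real.log_pos one_lt_two).ne'
  rw [shannonEntropy_def, Fin.sum_univ_three]
  simp [Real.negMulLog, shannon₃]
  field_simp
  ring

/-- The three marginals of the 6-letter law (real masses `pm, pl, ps, pr` on the two short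
patterns, the long pattern, the two `s`-corners and the `r`-corner). [folklore] -/
theorem marginalDist_full {pm pl ps pr : ℝ} {P : Fin 3 × Fin 3 × Fin 3 → ℝ}
    (hP : ∀ x, P x = if x = (1, 1, 0) then pm else if x = (0, 1, 1) then pm
      else if x = (1, 0, 1) then pl else if x = (2, 0, 0) then ps
      else if x = (0, 0, 2) then ps else if x = (0, 2, 0) then pr else 0) :
    marginalDist₁ P = ![pm + pr + ps, pl + pm, ps] ∧
      marginalDist₂ P = ![pl + 2 * ps, 2 * pm, pr] ∧
      marginalDist₃ P = ![pm + pr + ps, pl + pm, ps] := by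
  refine ⟨?_, ?_, ?_⟩ <;> funext i <;> fin_cases i <;>
    simp [marginalDist₁, marginalDist₂, marginalDist₃, Fin.sum_univ_three, hP] <;> ring

/-- **`D(P) = {P}` on the full Coppersmith–Winograd support** `{i + j + l = 2}`: ANY array `P` supported
there is determined by its three marginals — the level-`2` marginals read off the three corner letters
`(2,0,0), (0,2,0), (0,0,2)`, and then each level-`0` marginal contains exactly one matrix-pattern letter.
(Generalises `PerfectAmortisation.eq_of_mem_sameMarginalsOn_rect` from the 3-letter far-rectangular type to
every 6-letter type; this is the `Γ_S(P) = 0` ingredient of the full first-power certificate.) -/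
theorem eq_of_mem_sameMarginalsOn_cw {P P' : Fin 3 × Fin 3 × Fin 3 → ℝ}
    (hP0 : ∀ s, s ∉ cwSupport₃ → P s = 0) (hP' : P' ∈ sameMarginalsOn cwSupport₃ P) : P' = P := by
  obtain ⟨-, hoff, h₁, h₂, h₃⟩ := hP'
  have z' : ∀ a b c : Fin 3, (a : ℕ) + b + c ≠ 2 → P' (a, b, c) = 0 := fun a b c h =>
    hoff _ (mt mem_cwSupport₃.1 h)
  have z : ∀ a b c : Fin 3, (a : ℕ) + b + c ≠ 2 → P (a, b, c) = 0 := fun a b c h =>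
    hP0 _ (mt mem_cwSupport₃.1 h)
  have e₁ := congrFun h₁ 2
  have e₂ := congrFun h₂ 2
  have e₃ := congrFun h₃ 2
  have f₁ := congrFun h₁ 0
  have f₂ := congrFun h₂ 0
  have f₃ := congrFun h₃ 0
  simp (disch := decide) only [marginalDist₁, marginalDist₂, marginalDist₃, Fin.sum_univ_three, z, z',
    add_zero, zero_add] at e₁ e₂ e₃ f₁ f₂ f₃
  have p011 : P' (0, 1, 1) = P (0, 1, 1) := by linarith
  have p101 : P' (1, 0, 1) = P (1, 0, 1) := by linarith
  have p110 : P' (1, 1, 0) = P (1, 1, 0) := by linarith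
  funext s
  by_cases hs : s ∈ cwSupport₃
  · rw [mem_cwSupport₃_iff] at hs
    rcases hs with rfl | rfl | rfl | rfl | rfl | rfl <;>
      first | exact p011 | exact p101 | exact p110 | exact e₁ | exact e₂ | exact e₃
  · rw [hoff s hs, hP0 s hs]

/-- **The penalty vanishes on the whole CW support**: `Γ_S(P) ≤ 0` (hence `= 0`) for every distribution
`P` supported in `{i + j + l = 2}`. -/
theorem maxEntropyPenalty_cw_nonpos {P : Fin 3 × Fin 3 × Fin 3 → ℝ}
    (hP : P ∈ stdSimplex ℝ (Fin 3 × Fin 3 × Fin 3)) (hsupp : ∀ x, x ∉ cwSupport₃ → P x = 0) :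
    maxEntropyPenalty cwSupport₃ P ≤ 0 := by
  have hle : maxEntropyGivenMarginals cwSupport₃ P ≤ shannonEntropy P :=
    maxEntropyGivenMarginals_le ⟨P, self_mem_sameMarginalsOn hP hsupp⟩
      fun P' hP' => (congrArg shannonEntropy (eq_of_mem_sameMarginalsOn_cw hsupp hP')).le
  exact sub_nonpos.2 hle

/-- **B2′ (entropy side).** For the integer 6-letter type, in nats:
`min(H_X, H_Y) ≤ log 2 · (min_m H_bits(P_m) − Γ_S(P))`, where
`H_X = H₃(k·m/N + 2 s/N, 2 m/N, r/N)` (second marginal) and `H_Y = H₃(m/N + r/N + s/N, k·m/N + m/N, s/N)`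
(first = third marginal), because `Γ_S(P) ≤ 0` (`maxEntropyPenalty_cw_nonpos`). [folklore] -/
theorem cwFullEntropy :
    ∀ m k s r N : ℕ, 1 ≤ m → 1 ≤ k → (k + 2) * m + 2 * s + r = N →
      ∀ P : Fin 3 × Fin 3 × Fin 3 → ℝ,
      (∀ x, P x = ((if x = (1, 1, 0) then m else if x = (0, 1, 1) then m
          else if x = (1, 0, 1) then k * m else if x = (2, 0, 0) then s
          else if x = (0, 0, 2) then s else if x = (0, 2, 0) then r else 0 : ℕ) : ℝ) / (N : ℝ)) →
      min (shannon₃ ((k : ℝ) * ((m : ℝ) / N) + 2 * ((s : ℝ) / N)) (2 * ((m : ℝ) / N)) ((r : ℝ) / N))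
          (shannon₃ ((m : ℝ) / N + (r : ℝ) / N + (s : ℝ) / N) ((k : ℝ) * ((m : ℝ) / N) + (m : ℝ) / N)
            ((s : ℝ) / N)) ≤
        Real.log 2 * (min (shannonEntropy (marginalDist₁ P))
          (min (shannonEntropy (marginalDist₂ P)) (shannonEntropy (marginalDist₃ P))) -
          maxEntropyPenalty cwSupport₃ P) := by
  intro m k s r N hm hk hNdef P hP
  have hN0 : (0 : ℝ) < N := by
    have h3 : 3 ≤ (k + 2) * m := by nlinarith
    exact_mod_cast (by omega : 0 < N)
  have hNr : (N : ℝ) = ((k : ℝ) + 2) * m + 2 * s + r := by rw [← hNdef]; push_cast; ring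
  -- the law with real masses
  have hPr : ∀ x, P x = if x = (1, 1, 0) then (m : ℝ) / N else if x = (0, 1, 1) then (m : ℝ) / N
      else if x = (1, 0, 1) then (k : ℝ) * ((m : ℝ) / N) else if x = (2, 0, 0) then (s : ℝ) / N
      else if x = (0, 0, 2) then (s : ℝ) / N else if x = (0, 2, 0) then (r : ℝ) / N else 0 := by
    intro x
    rw [hP x]
    split_ifs <;> push_cast <;> ring
  -- off-support zeros and simplex membership
  have hoff : ∀ x, x ∉ cwSupport₃ → P x = 0 := by
    intro x hx
    rw [mem_cwSupport₃_iff] at hx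
    push Not at hx
    obtain ⟨h1, h2, h3, h4, h5, h6⟩ := hx
    rw [hPr x]
    simp [h1, h2, h3, h4, h5, h6]
  have hnonneg : ∀ x, 0 ≤ P x := by
    intro x
    rw [hP x]
    positivity
  have hsum : ∑ x, P x = 1 := by
    rw [sum_triple_eq]
    simp only [Fin.sum_univ_three, hPr]
    simp
    field_simp
    rw [hNr]
    ring
  have hsimp : P ∈ stdSimplex ℝ (Fin 3 × Fin 3 × Fin 3) := ⟨hnonneg, hsum⟩
  have hpen : maxEntropyPenalty cwSupport₃ P ≤ 0 := maxEntropyPenalty_cw_nonpos hsimp hoff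
  obtain ⟨h₁, h₂, h₃⟩ := marginalDist_full hPr
  have hlog : 0 < Real.log 2 := Real.log_pos one_lt_two
  rw [h₁, h₂, h₃]
  set A := shannonEntropy ![(m : ℝ) / N + (r : ℝ) / N + (s : ℝ) / N,
    (k : ℝ) * ((m : ℝ) / N) + (m : ℝ) / N, (s : ℝ) / N] with hA
  set B := shannonEntropy ![(k : ℝ) * ((m : ℝ) / N) + 2 * ((s : ℝ) / N), 2 * ((m : ℝ) / N),
    (r : ℝ) / N] with hB
  have hmin : min A (min B A) = min B A := by
    rw [min_comm B A, ← min_assoc, min_self]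
  have eA : Real.log 2 * A = shannon₃ ((m : ℝ) / N + (r : ℝ) / N + (s : ℝ) / N)
      ((k : ℝ) * ((m : ℝ) / N) + (m : ℝ) / N) ((s : ℝ) / N) := log_two_mul_shannonEntropy_vec3 _ _ _
  have eB : Real.log 2 * B = shannon₃ ((k : ℝ) * ((m : ℝ) / N) + 2 * ((s : ℝ) / N)) (2 * ((m : ℝ) / N))
      ((r : ℝ) / N) := log_two_mul_shannonEntropy_vec3 _ _ _
  rw [hmin, mul_sub, mul_min_of_nonneg _ _ hlog.le, eA, eB]
  have h2 : Real.log 2 * maxEntropyPenalty cwSupport₃ P ≤ 0 :=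
    mul_nonpos_of_nonneg_of_nonpos hlog.le hpen
  linarith


/-! ## Layer D′ — the certificate (copies of the `FarEdgeDescent_v4` definitions + assembly) -/

/-- Value of the full first-power `CW_q` certificate at the Y=Z-symmetric joint type (copy of the lens draft's
`FarEdgeDescent_v4.cwFullFirstPowerValue`; helper). -/
def cwFullFirstPowerValue (q k : ℕ) (σ ρ : ℝ) : ℝ :=
  (Real.log ((q : ℝ) + 2) -
      min (shannon₃ ((k : ℝ) * ((1 - 2 * σ - ρ) / ((k : ℝ) + 2)) + 2 * σ)
            (2 * ((1 - 2 * σ - ρ) / ((k : ℝ) + 2))) ρ)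
          (shannon₃ ((1 - 2 * σ - ρ) / ((k : ℝ) + 2) + ρ + σ)
            ((k : ℝ) * ((1 - 2 * σ - ρ) / ((k : ℝ) + 2)) + (1 - 2 * σ - ρ) / ((k : ℝ) + 2)) σ)) /
    ((1 - 2 * σ - ρ) / ((k : ℝ) + 2) * Real.log (q : ℝ))

/-- The integer certificate (copy of the lens draft's `CwFirstPowerIntegerCertificate`; helper). -/
def CwFirstPowerIntegerCertificate : Prop :=
  ∀ q k m s r : ℕ, 2 ≤ q → 1 ≤ k → 1 ≤ m →
    omegaRect ℂ 1 1 (k : ℝ) ≤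
      cwFullFirstPowerValue q k ((s : ℝ) / (((k : ℝ) + 2) * m + 2 * s + r)) ((r : ℝ) / (((k : ℝ) + 2) * m + 2 * s + r))

open Literature.Barriers.MatrixMultiplication in
/-- **The support, PROVED.** `ω(1,1,k) ≤ cwFullFirstPowerValue q k (s/N₀) (r/N₀)` for every integer
joint type (layers A, B1′, B2′, C′ and the `ω`-chain of `PerfectAmortisation.omegaRect_le_of_packing`:
`V a^{ω(1,1,k)} ≤ R̃(⟨V⟩ ⊗ ⟨a,a,a^k⟩) ≤ R̃(CW_q^{⊗N}) ≤ (q+2)^N ≤ V a^{E+δ}`, `a = q^{Lm}`, `N = L N₀`). -/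
theorem cwFirstPowerIntegerCertificate_holds : CwFirstPowerIntegerCertificate := by
  intro q k m s r hq hk hm
  obtain ⟨N₀, hN₀⟩ : ∃ N₀ : ℕ, N₀ = (k + 2) * m + 2 * s + r := ⟨_, rfl⟩
  have h3 : 3 ≤ (k + 2) * m := by nlinarith
  have hN₀2 : 2 ≤ N₀ := by omega
  have hN₀r : (N₀ : ℝ) = ((k : ℝ) + 2) * m + 2 * s + r := by rw [hN₀]; push_cast; ring
  have hN₀0 : (0 : ℝ) < N₀ := by exact_mod_cast (by omega : 0 < N₀)
  have hm0 : (0 : ℝ) < m := by exact_mod_cast (by omega : 0 < m)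
  have hk0 : (0 : ℝ) ≤ (k : ℝ) := Nat.cast_nonneg k
  have hq1 : (1 : ℝ) < q := by exact_mod_cast (lt_of_lt_of_le one_lt_two hq)
  rw [← hN₀r]
  -- `β = (1 − 2σ − ρ)/(k+2) = m/N₀`
  have key : (1 - 2 * ((s : ℝ) / N₀) - (r : ℝ) / N₀) / ((k : ℝ) + 2) = (m : ℝ) / N₀ := by
    field_simp
    rw [hN₀r]
    ring
  unfold cwFullFirstPowerValue
  rw [key]
  set Hmin : ℝ := min (shannon₃ ((k : ℝ) * ((m : ℝ) / N₀) + 2 * ((s : ℝ) / N₀)) (2 * ((m : ℝ) / N₀))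
      ((r : ℝ) / N₀))
    (shannon₃ ((m : ℝ) / N₀ + (r : ℝ) / N₀ + (s : ℝ) / N₀) ((k : ℝ) * ((m : ℝ) / N₀) + (m : ℝ) / N₀)
      ((s : ℝ) / N₀)) with hHmin
  refine le_of_forall_pos_lt_add fun δ hδ => ?_
  obtain ⟨L, hL, hC⟩ := cwFullThreshold q m N₀ hq hm hN₀2 Hmin (δ / 2) (half_pos hδ)
  have hL0 : (0 : ℝ) < L := by exact_mod_cast (by omega : 0 < L)
  -- the scaled type `L·Q`
  have hNL : (k + 2) * (L * m) + 2 * (L * s) + L * r = L * N₀ := by rw [hN₀]; ring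
  set P : Fin 3 × Fin 3 × Fin 3 → ℝ := fun x =>
    ((if x = (1, 1, 0) then L * m else if x = (0, 1, 1) then L * m
        else if x = (1, 0, 1) then k * (L * m) else if x = (2, 0, 0) then L * s
        else if x = (0, 0, 2) then L * s else if x = (0, 2, 0) then L * r else 0 : ℕ) : ℝ) /
      (((L * N₀ : ℕ) : ℝ)) with hPdef
  have hPs : ∀ x, P x = ((if x = (1, 1, 0) then L * m else if x = (0, 1, 1) then L * m
        else if x = (1, 0, 1) then k * (L * m) else if x = (2, 0, 0) then L * s
        else if x = (0, 0, 2) then L * s else if x = (0, 2, 0) then L * r else 0 : ℕ) : ℝ) /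
      (((L * N₀ : ℕ) : ℝ)) := fun x => rfl
  have hLm : 1 ≤ L * m := Nat.mul_pos (by omega) (by omega)
  obtain ⟨Δ, hS, hcnt, hfree, hsize⟩ := cwFullDiagonalRaw (L * m) k (L * s) (L * r) (L * N₀) hLm hk hNL P hPs
  have hent := cwFullEntropy (L * m) k (L * s) (L * r) (L * N₀) hLm hk hNL P hPs
  -- scale invariance of the masses
  have c1 : (((L * m : ℕ) : ℝ)) / (((L * N₀ : ℕ) : ℝ)) = (m : ℝ) / N₀ := by
    rw [Nat.cast_mul, Nat.cast_mul, mul_div_mul_left _ _ hL0.ne']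
  have c2 : (((L * s : ℕ) : ℝ)) / (((L * N₀ : ℕ) : ℝ)) = (s : ℝ) / N₀ := by
    rw [Nat.cast_mul, Nat.cast_mul, mul_div_mul_left _ _ hL0.ne']
  have c3 : (((L * r : ℕ) : ℝ)) / (((L * N₀ : ℕ) : ℝ)) = (r : ℝ) / N₀ := by
    rw [Nat.cast_mul, Nat.cast_mul, mul_div_mul_left _ _ hL0.ne']
  rw [c1, c2, c3] at hent
  -- `exp(N · Hmin) ≤ 2^{N (min H − Γ)} ≤ |Δ| · loss`
  set X : ℝ := min (shannonEntropy (marginalDist₁ P))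
      (min (shannonEntropy (marginalDist₂ P)) (shannonEntropy (marginalDist₃ P))) -
      maxEntropyPenalty cwSupport₃ P with hX
  have hNn : (0 : ℝ) ≤ (((L * N₀ : ℕ) : ℝ)) := Nat.cast_nonneg _
  have hexp : Real.exp ((((L * N₀ : ℕ) : ℝ)) * Hmin) ≤ (2 : ℝ) ^ ((((L * N₀ : ℕ) : ℝ)) * X) := by
    rw [Real.rpow_def_of_pos two_pos, Real.exp_le_exp]
    calc (((L * N₀ : ℕ) : ℝ)) * Hmin ≤ (((L * N₀ : ℕ) : ℝ)) * (Real.log 2 * X) :=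
          mul_le_mul_of_nonneg_left hent hNn
      _ = Real.log 2 * ((((L * N₀ : ℕ) : ℝ)) * X) := by ring
  have hnum := hC Δ.card (hexp.trans hsize)
  -- the tensor layer and the `ω`-chain
  have hres := stub_cwRectRestriction q (L * m) (L * m) (k * (L * m)) (L * N₀) Δ hS hcnt hfree
  have hdeg : PolyDegeneratesTo (kroneckerPow (bigCwTensor ℂ q) (L * N₀))
      (kroneckerTensor (unitTensor ℂ Δ.card)
        (matMulTensor ℂ (q ^ (L * m)) (q ^ (L * m)) (q ^ (k * (L * m))))) := hres.polyDegeneratesTo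
  have hV : 1 ≤ Δ.card := by
    by_contra h0
    have h0' : Δ.card = 0 := by omega
    rw [h0', Nat.cast_zero, zero_mul, zero_mul, zero_mul] at hsize
    exact absurd (hexp.trans hsize) (not_le.2 (Real.exp_pos _))
  have hNpos : 1 ≤ L * N₀ := Nat.mul_pos (by omega) (by omega)
  have ha : 2 ≤ q ^ (L * m) := le_trans hq (Nat.le_self_pow (by omega) q)
  have haB : (q ^ (L * m)) ^ k ≤ q ^ (k * (L * m)) := by rw [← pow_mul, mul_comm]
  have ha1 : (1 : ℝ) < ((q ^ (L * m) : ℕ) : ℝ) := by exact_mod_cast (by omega : 1 < q ^ (L * m))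
  have hV0 : (0 : ℝ) < (Δ.card : ℝ) := by exact_mod_cast (by omega : 0 < Δ.card)
  have hVr : 1 ≤ Δ.card := hV
  have haB' : (((q ^ (L * m) : ℕ) : ℝ)) ^ (k : ℝ) ≤ (((q ^ (k * (L * m)) : ℕ) : ℝ)) := by
    rw [Real.rpow_natCast]
    exact_mod_cast haB
  have h1 := mul_rpow_omegaRect_le_asymptoticRank ℂ hk0 hVr ha haB'
  have h2 := asymptoticRank_le_of_polyDegeneratesTo hdeg
  have hcw : asymptoticRank (bigCwTensor ℂ q) ≤ (q : ℝ) + 2 := by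
    exact_mod_cast asymptoticRank_bigCwTensor_le ℂ q
  have h3' : asymptoticRank (kroneckerPow (bigCwTensor ℂ q) (L * N₀)) ≤ ((q : ℝ) + 2) ^ (L * N₀) :=
    (asymptoticRank_kroneckerPow_le _ hNpos).trans
      (pow_le_pow_left₀ (asymptoticRank_nonneg _) hcw _)
  set E : ℝ := (Real.log ((q : ℝ) + 2) - Hmin) / ((m : ℝ) / (N₀ : ℝ) * Real.log (q : ℝ)) with hE
  have hchain : (Δ.card : ℝ) * (((q ^ (L * m) : ℕ) : ℝ)) ^ omegaRect ℂ 1 1 (k : ℝ) ≤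
      (Δ.card : ℝ) * (((q ^ (L * m) : ℕ) : ℝ)) ^ (E + δ / 2) :=
    h1.trans (h2.trans (h3'.trans hnum))
  have h4 : (((q ^ (L * m) : ℕ) : ℝ)) ^ omegaRect ℂ 1 1 (k : ℝ) ≤
      (((q ^ (L * m) : ℕ) : ℝ)) ^ (E + δ / 2) :=
    le_of_mul_le_mul_left hchain hV0
  have h5 : omegaRect ℂ 1 1 (k : ℝ) ≤ E + δ / 2 := (Real.rpow_le_rpow_left_iff ha1).1 h4
  linarith

/-! ## The `s = r = 0` slice and the closed form at `q = 2k + 2` -/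

/-- Two-cell Shannon entropy is the binary entropy. -/
theorem shannon₃_two (p : ℝ) : shannon₃ p (1 - p) 0 = Real.binEntropy p := by
  unfold shannon₃
  rw [Real.binEntropy_eq_negMulLog_add_negMulLog_one_sub, Real.negMulLog, Real.negMulLog, Real.log_zero]
  ring

/-- CONSISTENCY: the `σ = ρ = 0` slice of the full certificate value is the tree's kernel-family bound
`f(k,q) = (k+2)(log(q+2) − h(1/(k+2)))/log q` of `PerfectAmortisation.omegaRect_le_of_packing` — so the `s = r = 0`
instances of `CwFirstPowerIntegerCertificate` are exactly that landed theorem (the module has no hub olean, hence not imported). -/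
theorem cwFullFirstPowerValue_zero (q k : ℕ) (hk : 1 ≤ k) :
    cwFullFirstPowerValue q k 0 0 =
      ((k : ℝ) + 2) * (Real.log ((q : ℝ) + 2) - Real.binEntropy (1 / ((k : ℝ) + 2))) / Real.log (q : ℝ) := by
  have hkR : (1 : ℝ) ≤ (k : ℝ) := by exact_mod_cast hk
  have hk2 : (0 : ℝ) < (k : ℝ) + 2 := by linarith
  unfold cwFullFirstPowerValue
  have e0 : (1 - 2 * (0 : ℝ) - 0) / ((k : ℝ) + 2) = 1 / ((k : ℝ) + 2) := by ring
  rw [e0]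
  have eX1 : (k : ℝ) * (1 / ((k : ℝ) + 2)) + 2 * 0 = 1 - 2 / ((k : ℝ) + 2) := by field_simp; ring
  have eX2 : 2 * (1 / ((k : ℝ) + 2)) = 2 / ((k : ℝ) + 2) := by ring
  have eY1 : 1 / ((k : ℝ) + 2) + 0 + 0 = 1 / ((k : ℝ) + 2) := by ring
  have eY2 : (k : ℝ) * (1 / ((k : ℝ) + 2)) + 1 / ((k : ℝ) + 2) = 1 - 1 / ((k : ℝ) + 2) := by field_simp; ring
  rw [eX1, eX2, eY1, eY2]
  -- X-entropy = h(2/(k+2)) (cells permuted), Y-entropy = h(1/(k+2))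
  have hX : shannon₃ (1 - 2 / ((k : ℝ) + 2)) (2 / ((k : ℝ) + 2)) 0 = Real.binEntropy (2 / ((k : ℝ) + 2)) := by
    rw [← Real.binEntropy_one_sub, ← shannon₃_two]
    unfold shannon₃; ring_nf
  have hY : shannon₃ (1 / ((k : ℝ) + 2)) (1 - 1 / ((k : ℝ) + 2)) 0 = Real.binEntropy (1 / ((k : ℝ) + 2)) :=
    shannon₃_two _
  rw [hX, hY]
  -- h(1/(k+2)) ≤ h(2/(k+2)): monotone on [0,1/2] for k ≥ 2, symmetric equality for k = 1
  have hmin : min (Real.binEntropy (2 / ((k : ℝ) + 2))) (Real.binEntropy (1 / ((k : ℝ) + 2))) =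
      Real.binEntropy (1 / ((k : ℝ) + 2)) := by
    apply min_eq_right
    rcases eq_or_lt_of_le hk with h1 | h2
    · -- k = 1
      have : (k : ℝ) = 1 := by exact_mod_cast h1.symm
      rw [this, show (2 : ℝ) / (1 + 2) = 1 - 1 / (1 + 2) by norm_num, Real.binEntropy_one_sub]
    · have hk2' : (2 : ℝ) ≤ (k : ℝ) := by exact_mod_cast h2
      apply Real.binEntropy_strictMonoOn.monotoneOn
      · constructor
        · positivity
        · rw [div_le_iff₀ hk2]; linarith
      · constructor
        · positivity
        · rw [div_le_iff₀ hk2]; linarith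
      · exact div_le_div_of_nonneg_right (by norm_num) hk2.le
  rw [hmin]
  field_simp

/-- The first-power `CW_q` far-rectangular bound `ω(1,1,k) ≤ (k+2)(log(q+2) − h(1/(k+2)))/log q`
(= the landed `PerfectAmortisation.omegaRect_le_of_packing cwLaserPacking_of_stubs`, re-derived). -/
theorem cwFirstPowerBound (q k : ℕ) (hq : 2 ≤ q) (hk : 1 ≤ k) :
    omegaRect ℂ 1 1 (k : ℝ) ≤
      ((k : ℝ) + 2) * (Real.log ((q : ℝ) + 2) - Real.binEntropy (1 / ((k : ℝ) + 2))) / Real.log (q : ℝ) := by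
  have h := cwFirstPowerIntegerCertificate_holds q k 1 0 0 hq hk le_rfl
  simp only [Nat.cast_zero, zero_div] at h
  rwa [cwFullFirstPowerValue_zero q k hk] at h

/-- **Aside `LogRate` of route `FarEdgeDescent`, by name.** The closed form at `q = 2k+2`:
`f(k, 2k+2) = k + 1 + log 2 / log(2k+2)`. -/
theorem logRate : Summit.MatrixMultiplication.MatrixMultiplication.Theses.FarEdgeDescent.LogRate := by
  intro k hk
  have hq : 2 ≤ 2 * k + 2 := by omega
  have hb := cwFirstPowerBound (2 * k + 2) k hq hk
  rw [← omegaRect_one_mid_one ℂ (k : ℝ)] at hb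
  push_cast at hb
  have hk' : (1 : ℝ) ≤ k := by exact_mod_cast hk
  set K : ℝ := (k : ℝ) with hK
  have h1 : (0 : ℝ) < K + 1 := by linarith
  have h2 : (0 : ℝ) < K + 2 := by linarith
  have hl2 : 0 < Real.log 2 := Real.log_pos (by norm_num)
  have hL1 : 0 ≤ Real.log (K + 1) := Real.log_nonneg (by linarith)
  have elog4 : Real.log (2 * K + 2 + 2) = Real.log 2 + Real.log (K + 2) := by
    rw [show (2 : ℝ) * K + 2 + 2 = 2 * (K + 2) by ring, Real.log_mul (by norm_num) h2.ne']
  have elog2 : Real.log (2 * K + 2) = Real.log 2 + Real.log (K + 1) := by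
    rw [show (2 : ℝ) * K + 2 = 2 * (K + 1) by ring, Real.log_mul (by norm_num) h1.ne']
  have e2 : 1 - 1 / (K + 2) = (K + 1) / (K + 2) := by
    rw [eq_div_iff h2.ne', sub_mul, one_div, inv_mul_cancel₀ h2.ne']
    ring
  have ebin : Real.binEntropy (1 / (K + 2)) =
      (1 / (K + 2)) * Real.log (K + 2) + ((K + 1) / (K + 2)) * (Real.log (K + 2) - Real.log (K + 1)) := by
    rw [Real.binEntropy, e2, one_div, inv_inv, inv_div, Real.log_div h2.ne' h1.ne', ← one_div]
  rw [elog4, ebin] at hb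
  have hden : 0 < Real.log 2 + Real.log (K + 1) := by linarith
  have target : (K + 2) * (Real.log 2 + Real.log (K + 2) -
      ((1 / (K + 2)) * Real.log (K + 2) + ((K + 1) / (K + 2)) * (Real.log (K + 2) - Real.log (K + 1)))) /
      Real.log (2 * K + 2) = K + 1 + Real.log 2 / Real.log (2 * K + 2) := by
    rw [elog2, div_eq_iff hden.ne']
    field_simp [h2.ne', hden.ne']
    ring
  rw [target] at hb
  exact hb

end Summit.MatrixMultiplication.MatrixMultiplication.Theorems.FarEdgeDescentLogRate

end
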